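import Mathlib
import HarnessLib
import Summits.HubbardSuperconductivity.HubbardSuperconductivity.Theorems.KLProgrammeKLRegimeSplitBundleV15

/-!
# Raising the tree-expansion constant `CE` and the two-leg `|U|`-slacks `S' j` of an engine package `Q` — the `Q`-side transfer toolkit for a possible
# gen-6 package step `klEngQ5 P R ↦ klEngQ6 P R := (klEngQ5 P R).raiseCE ce s'` (plan g14 (R17); k3c3-p3's MS-A34 verdict, STATUS 2026-08-27 07:11Z:
# the (E3a-MS) slot fit wants `Q.CE·G.S₁ ≥ (F-Q)(R)` and `R`-dependent base terms behind `Q.S'`; cell gate-hubbard-kl, seat hubbard-kl-k3c2-p2 g6)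

Companion of `…SplitGeoRaiseTwoLeg` (the `G`-side door).  For ANY `Q : EngConsts`, `ce : ℝ`, `s' : ℕ → ℝ`:

* §1 **`EngConsts.raiseCE Q ce s' := { Q with CE := max Q.CE ce, S' := fun j => max (Q.S' j) (s' j) }`**, `rfl` rows for the untouched fields
  (`CR`, `c0`, `cE4`, `Bf`, `SL`, `CL`, `L0`, `M0`), the inequalities `Q.CE ≤ _`, `ce ≤ _`, `Q.S' j ≤ _`, `s' j ≤ _`, **`EngConsts.raiseCE_wf`**;
* §2 majorants: `eremBar`, `legDressBarQ`, `legDressBarQ2`, `lipBar`, `bflBar` are unchanged (`rfl`); `twoLegBar` and `msBarQ` GROW (`G.WF`, `Q.WF`);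
* §3 predicates: the value clauses (E2-v10)/(E2″-v7)/(E2′-S4)/(E2′-S3uv), (E4) `EngineFirstMoments`, (E5-S), `PairArrayAtV2`, `BetaSplitAtS2` are
  INVARIANT (`Iff.rfl`: they read `Q` only through `CR`, `CL`, `cE4`); (E1-v4) `KernelNormsV4` transfers COVARIANTLY (`CE^p` monotone), hence
  **`engineBoundsAtV10S_raiseCE_of`**; two-leg OUTPUT clauses at a fixed history transfer covariantly (`TwoLegSizesT1Fn`, `TwoLegSizesMSFnQ/MSTQ`,
  `FrameLipschitzFnTD hist` (iff), `TwoLegCoreTD hist`).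

NOT covered (not true by monotonicity): the comparison history `histV15 … Q …` (its engine component contains `KernelNormsV4`, which WEAKENS under the
raise, so `FrameLipschitzFnTD (histV15 … (Q.raiseCE …) …)` and the (E3f-AT) antecedent are not implied) and `HistP` in hypothesis position — closers there
must be `Q`-parametric or keyed at the registered package.  Definitions with bodies + order lemmas; nothing about the model is asserted.
-/

namespace Summit.HubbardSuperconductivity.HubbardSuperconductivity.Theorems.KLRegimeSplit

noncomputable section

set_option linter.dupNamespace false -- summit = problem name (single-conjunct summit), D-0017

open Real Finset Literature.MathematicalPhysics.QuantumLattice Literature.Probability.LatticeModels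
open Summit.HubbardSuperconductivity.HubbardSuperconductivity.Theorems.KLProgrammeLegKernels

/-! ## §1 The raised package -/

/-- **`Q.raiseCE ce s'`** — the engine package `Q` with `CE := max Q.CE ce` and `S' := fun j => max (Q.S' j) (s' j)`, every other field untouched. -/
def EngConsts.raiseCE (Q : EngConsts) (ce : ℝ) (s' : ℕ → ℝ) : EngConsts :=
  { Q with CE := max Q.CE ce, S' := fun j => max (Q.S' j) (s' j) }

namespace EngConsts

variable (Q : EngConsts) (ce : ℝ) (s' : ℕ → ℝ)

/-- `(Q.raiseCE ce s').CE = max Q.CE ce`. -/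
theorem raiseCE_CE : (Q.raiseCE ce s').CE = max Q.CE ce := rfl
/-- `(Q.raiseCE ce s').S' j = max (Q.S' j) (s' j)`. -/
theorem raiseCE_S' (j : ℕ) : (Q.raiseCE ce s').S' j = max (Q.S' j) (s' j) := rfl
/-- untouched field `CR`. -/
theorem raiseCE_CR : (Q.raiseCE ce s').CR = Q.CR := rfl
/-- untouched field `c0`. -/
theorem raiseCE_c0 : (Q.raiseCE ce s').c0 = Q.c0 := rfl
/-- untouched field `cE4`. -/
theorem raiseCE_cE4 : (Q.raiseCE ce s').cE4 = Q.cE4 := rfl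
/-- untouched field `Bf`. -/
theorem raiseCE_Bf : (Q.raiseCE ce s').Bf = Q.Bf := rfl
/-- untouched field `SL`. -/
theorem raiseCE_SL : (Q.raiseCE ce s').SL = Q.SL := rfl
/-- untouched field `CL`. -/
theorem raiseCE_CL : (Q.raiseCE ce s').CL = Q.CL := rfl
/-- untouched field `L0`. -/
theorem raiseCE_L0 : (Q.raiseCE ce s').L0 = Q.L0 := rfl
/-- untouched field `M0`. -/
theorem raiseCE_M0 : (Q.raiseCE ce s').M0 = Q.M0 := rfl

/-- `Q.CE ≤ (Q.raiseCE ce s').CE`. -/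
theorem CE_le_raiseCE_CE : Q.CE ≤ (Q.raiseCE ce s').CE := le_max_left _ _
/-- `ce ≤ (Q.raiseCE ce s').CE`. -/
theorem le_raiseCE_CE : ce ≤ (Q.raiseCE ce s').CE := le_max_right _ _
/-- `Q.S' j ≤ (Q.raiseCE ce s').S' j`. -/
theorem S'_le_raiseCE_S' (j : ℕ) : Q.S' j ≤ (Q.raiseCE ce s').S' j := le_max_left _ _
/-- `s' j ≤ (Q.raiseCE ce s').S' j`. -/
theorem le_raiseCE_S' (j : ℕ) : s' j ≤ (Q.raiseCE ce s').S' j := le_max_right _ _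

variable {Q}

/-- **Raising `CE`, `S'` preserves well-formedness** (they enter `EngConsts.WF` only through `0 ≤ CE`, `0 ≤ S' j`). -/
theorem raiseCE_wf (hQ : Q.WF) (ce : ℝ) (s' : ℕ → ℝ) : (Q.raiseCE ce s').WF := by
  obtain ⟨h1, h2, h3, h4, h5, h6, h7, h8⟩ := hQ
  exact ⟨le_max_of_le_left h1, h2, h3, h4, fun j => le_max_of_le_left (h5 j), h6, h7, h8⟩

end EngConsts

/-! ## §2 The majorants under `raiseCE` -/

section Bars

variable (G : GeoConsts) (P : SplitConsts) (Q : EngConsts) (ce : ℝ) (s' : ℕ → ℝ)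

/-- `eremBar` reads only `CR`, `CL`. -/
theorem eremBar_raiseCE (U β : ℝ) (L n : ℕ) : eremBar G P (Q.raiseCE ce s') U β L n = eremBar G P Q U β L n := rfl
/-- `legDressBarQ` reads only `CR`. -/
theorem legDressBarQ_raiseCE (U : ℝ) (n c : ℕ) : legDressBarQ G P (Q.raiseCE ce s') U n c = legDressBarQ G P Q U n c := rfl
/-- `legDressBarQ2` reads only `CR`. -/
theorem legDressBarQ2_raiseCE (U : ℝ) (n c : ℕ) : legDressBarQ2 G P (Q.raiseCE ce s') U n c = legDressBarQ2 G P Q U n c := rfl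
/-- `lipBar` reads only `Q.SL`. -/
theorem lipBar_raiseCE (U : ℝ) (n : ℕ) : lipBar G (Q.raiseCE ce s') U n = lipBar G Q U n := rfl
/-- `bflBar` reads only `Q.Bf`. -/
theorem bflBar_raiseCE (U : ℝ) (n : ℕ) : bflBar G (Q.raiseCE ce s') U n = bflBar G Q U n := rfl

variable {G Q}

/-- **`twoLegBar` grows** under `raiseCE` (through `S'`; `0 ≤ G.S j` from `G.WF`, `0 ≤ Q.S' j` from `Q.WF`). -/
theorem twoLegBar_le_raiseCE (hG : G.WF) (U : ℝ) (j n : ℕ) :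
    twoLegBar G Q U j n ≤ twoLegBar G (Q.raiseCE ce s') U j n := by
  unfold twoLegBar
  have hS : 0 ≤ G.S j := hG.2.2.2.2.2.2.2.2.2.2.2.2.2.2.2.2.2.1 j
  have h1 : G.S j + Q.S' j * |U| ≤ G.S j + (Q.raiseCE ce s').S' j * |U| := by
    have := EngConsts.S'_le_raiseCE_S' Q ce s' j
    nlinarith [abs_nonneg U]
  have h2 : 0 ≤ uPow j U * (4 : ℝ) ^ (((j : ℤ) - 2) * n) := mul_nonneg (uPow_nonneg j U) (zpow_nonneg (by norm_num) _)
  calc (G.S j + Q.S' j * |U|) * uPow j U * (4 : ℝ) ^ (((j : ℤ) - 2) * n)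
      = (G.S j + Q.S' j * |U|) * (uPow j U * (4 : ℝ) ^ (((j : ℤ) - 2) * n)) := by ring
    _ ≤ (G.S j + (Q.raiseCE ce s').S' j * |U|) * (uPow j U * (4 : ℝ) ^ (((j : ℤ) - 2) * n)) :=
        mul_le_mul_of_nonneg_right h1 h2
    _ = (G.S j + (Q.raiseCE ce s').S' j * |U|) * uPow j U * (4 : ℝ) ^ (((j : ℤ) - 2) * n) := by ring

/-- **`msBarQ` grows** under `raiseCE` (through `CE` and `S' 1`; `G.WF`, `Q.WF`). -/
theorem msBarQ_le_raiseCE (hG : G.WF) (hQ : Q.WF) (U : ℝ) (n : ℕ) : msBarQ G Q U n ≤ msBarQ G (Q.raiseCE ce s') U n := by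
  unfold msBarQ
  have h1 := twoLegBar_le_raiseCE ce s' hG U 1 n (Q := Q)
  have h0 : 0 ≤ twoLegBar G Q U 1 n := twoLegBar_nonneg' hG hQ U 1 n
  have h0' : 0 ≤ twoLegBar G (Q.raiseCE ce s') U 1 n := h0.trans h1
  have hCE := EngConsts.CE_le_raiseCE_CE Q ce s'
  exact mul_le_mul hCE h1 h0 (hQ.1.trans hCE)

end Bars

/-! ## §3 Predicate level -/

section Model

variable {L M : ℕ} [NeZero L] [NeZero M] {G : GeoConsts} {P : SplitConsts} {Q : EngConsts} {ce : ℝ} {s' : ℕ → ℝ} {R : RenConsts}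
  {β U μ : ℝ} {K : TrigPolyC4v} {n : ℕ}

/-- (E2-v10) does not read `CE`, `S'`. -/
theorem pairLadderStepAtV10_raiseCE_iff (ce : ℝ) (s' : ℕ → ℝ) :
    PairLadderStepAtV10 L M G P (Q.raiseCE ce s') β U μ K n ↔ PairLadderStepAtV10 L M G P Q β U μ K n := Iff.rfl

/-- (E2″-v7) does not read `CE`, `S'`. -/
theorem pairValueIncrementAtV7_raiseCE_iff (ce : ℝ) (s' : ℕ → ℝ) :
    PairValueIncrementAtV7 L M G P (Q.raiseCE ce s') β U μ K n ↔ PairValueIncrementAtV7 L M G P Q β U μ K n := Iff.rfl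

/-- (E2′-S4) does not read `CE`, `S'`. -/
theorem quarticValueIncrementAtS4_raiseCE_iff (ce : ℝ) (s' : ℕ → ℝ) :
    QuarticValueIncrementAtS4 L M G P (Q.raiseCE ce s') β U μ K n ↔ QuarticValueIncrementAtS4 L M G P Q β U μ K n := Iff.rfl

/-- (E2′-S3uv) does not read `CE`, `S'`. -/
theorem quarticValueUVAtS3_raiseCE_iff (ce : ℝ) (s' : ℕ → ℝ) :
    QuarticValueUVAtS3 L M G P (Q.raiseCE ce s') β U μ K n ↔ QuarticValueUVAtS3 L M G P Q β U μ K n := Iff.rfl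

/-- (E4) reads only `Q.cE4`. -/
theorem engineFirstMoments_raiseCE_iff (ce : ℝ) (s' : ℕ → ℝ) :
    EngineFirstMoments L M G P (Q.raiseCE ce s') β U μ K n ↔ EngineFirstMoments L M G P Q β U μ K n := Iff.rfl

/-- `PairArrayAtV2` reads only `Q.CR`. -/
theorem pairArrayAtV2_raiseCE_iff (ce : ℝ) (s' : ℕ → ℝ) :
    PairArrayAtV2 L M P (Q.raiseCE ce s') β U μ K n ↔ PairArrayAtV2 L M P Q β U μ K n := Iff.rfl

/-- `BetaSplitAtS2` reads only `Q.CR`. -/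
theorem betaSplitAtS2_raiseCE_iff (ce : ℝ) (s' : ℕ → ℝ) :
    BetaSplitAtS2 L M G P (Q.raiseCE ce s') β U μ K n ↔ BetaSplitAtS2 L M G P Q β U μ K n := Iff.rfl

omit [NeZero M] in
/-- **(E1-v4) transfers covariantly**: `KernelNormsV4 … Q … n → KernelNormsV4 … (Q.raiseCE ce s') … n` (`Q.WF` for `0 ≤ Q.CE`; `0 ≤ P.Klam`). -/
theorem kernelNormsV4_raiseCE_of (hQ : Q.WF) (hK : 0 ≤ P.Klam) (h : KernelNormsV4 L M P Q β U μ K n) :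
    KernelNormsV4 L M P (Q.raiseCE ce s') β U μ K n := by
  intro p hp
  refine (h p hp).trans ?_
  have hε : 0 ≤ epsCoupling P U n := by
    unfold epsCoupling; exact mul_nonneg hK (by positivity)
  have hCE : Q.CE ^ p ≤ (Q.raiseCE ce s').CE ^ p := pow_le_pow_left₀ hQ.1 (EngConsts.CE_le_raiseCE_CE Q ce s') p
  have h2 : 0 ≤ (epsCoupling P U n) ^ (p - 1) * (2 : ℝ) ^ ((3 * (p : ℤ) - 5) * n) :=
    mul_nonneg (pow_nonneg hε _) (zpow_nonneg (by norm_num) _)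
  calc Q.CE ^ p * (epsCoupling P U n) ^ (p - 1) * (2 : ℝ) ^ ((3 * (p : ℤ) - 5) * n)
      = Q.CE ^ p * ((epsCoupling P U n) ^ (p - 1) * (2 : ℝ) ^ ((3 * (p : ℤ) - 5) * n)) := by ring
    _ ≤ (Q.raiseCE ce s').CE ^ p * ((epsCoupling P U n) ^ (p - 1) * (2 : ℝ) ^ ((3 * (p : ℤ) - 5) * n)) :=
        mul_le_mul_of_nonneg_right hCE h2
    _ = (Q.raiseCE ce s').CE ^ p * (epsCoupling P U n) ^ (p - 1) * (2 : ℝ) ^ ((3 * (p : ℤ) - 5) * n) := by ring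

/-- **The V10 engine slot transfers covariantly** under `raiseCE` (`Q.WF`, `0 ≤ P.Klam`): only (E1-v4) changes, and it weakens. -/
theorem engineBoundsAtV10S_raiseCE_of (hQ : Q.WF) (hK : 0 ≤ P.Klam) (h : EngineBoundsAtV10S L M G P Q β U μ K n) :
    EngineBoundsAtV10S L M G P (Q.raiseCE ce s') β U μ K n :=
  ⟨h.1, kernelNormsV4_raiseCE_of hQ hK h.2.1, h.2.2.1, h.2.2.2.1, h.2.2.2.2.1, h.2.2.2.2.2.1, h.2.2.2.2.2.2.1, h.2.2.2.2.2.2.2⟩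

/-- **(E3a-T1) transfers covariantly** (`G.WF`). -/
theorem twoLegSizesT1Fn_raiseCE_of (hG : G.WF) {f : FrameFn} (h : TwoLegSizesT1Fn L M G Q β U μ f n) :
    TwoLegSizesT1Fn L M G (Q.raiseCE ce s') β U μ f n :=
  ⟨h.1, fun j hj q => (h.2 j hj q).trans (twoLegBar_le_raiseCE ce s' hG U j n)⟩

/-- (E3c-TD) at a fixed history is unchanged (`lipBar` reads `Q.SL` only). -/
theorem frameLipschitzFnTD_raiseCE_iff {hist : TrigPolyC4v → ℕ → Prop} (ce : ℝ) (s' : ℕ → ℝ) :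
    FrameLipschitzFnTD L M hist G (Q.raiseCE ce s') R β U μ K n ↔ FrameLipschitzFnTD L M hist G Q R β U μ K n := Iff.rfl

/-- **(E3a-MS-FnQ) transfers covariantly** (`G.WF`, `Q.WF`, `R.WF`). -/
theorem twoLegSizesMSFnQ_raiseCE_of (hG : G.WF) (hQ : Q.WF) (hR : R.WF) {f : FrameFn} (h : TwoLegSizesMSFnQ L M G Q R β U μ f n) :
    TwoLegSizesMSFnQ L M G (Q.raiseCE ce s') R β U μ f n := by
  obtain ⟨lp, h1, h2, h3, h4⟩ := h
  refine ⟨lp, h1, h2, fun j hj q => (h3 j hj q).trans (twoLegBar_le_raiseCE ce s' hG U j n), fun m hm j hj q => ?_⟩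
  refine (h4 m hm j hj q).trans ?_
  have hb : 0 ≤ R.Gfr j * uPow j U * (4 : ℝ) ^ (((j : ℤ) - 2) * m) :=
    mul_nonneg (mul_nonneg (hR.2.2 j) (uPow_nonneg j U)) (zpow_nonneg (by norm_num) _)
  exact mul_le_mul_of_nonneg_right (msBarQ_le_raiseCE ce s' hG hQ U n) hb

/-- (E3a-MS-TQ) transfers covariantly. -/
theorem twoLegSizesMSTQ_raiseCE_of (hG : G.WF) (hQ : Q.WF) (hR : R.WF) (h : TwoLegSizesMSTQ L M G Q R β U μ K n) :
    TwoLegSizesMSTQ L M G (Q.raiseCE ce s') R β U μ K n :=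
  twoLegSizesMSFnQ_raiseCE_of hG hQ hR h

/-- **`TwoLegCoreTD hist` transfers covariantly at a fixed history** (`G.WF`; (E3d/e) `TwoLegSlopes` does not read `Q`). -/
theorem twoLegCoreTD_raiseCE_of (hG : G.WF) {hist : TrigPolyC4v → ℕ → Prop} (h : TwoLegCoreTD L M hist G P Q R β U μ K n) :
    TwoLegCoreTD L M hist G P (Q.raiseCE ce s') R β U μ K n :=
  ⟨twoLegSizesT1Fn_raiseCE_of hG h.1, (frameLipschitzFnTD_raiseCE_iff ce s').2 h.2.1, h.2.2⟩

/-- The comparison history WEAKENS under the raise: `histV15 … Q … K' j → histV15 … (Q.raiseCE ce s') … K' j` (`Q.WF`, `0 ≤ P.Klam`) — the direction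
that does NOT transfer `FrameLipschitzFnTD (histV15 …)`; recorded so that closers know which side they are on. -/
theorem histV15_raiseCE_of (hQ : Q.WF) (hK : 0 ≤ P.Klam) {K' : TrigPolyC4v} {j : ℕ} (h : histV15 L M G P Q R β U μ K' j) :
    histV15 L M G P (Q.raiseCE ce s') R β U μ K' j :=
  ⟨(betaSplitAtS2_raiseCE_iff ce s').2 h.1, h.2.1, engineBoundsAtV10S_raiseCE_of hQ hK h.2.2⟩

end Model

end

end Summit.HubbardSuperconductivity.HubbardSuperconductivity.Theorems.KLRegimeSplit
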